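import Mathlib

/-!
# SoloInformed — the double-coset arithmetic behind the splitting no-go for HKM's 3-torus

Context: Hughes–Kim–Miller, *Branched covers of twist-roll spun knots*, arXiv:2402.11706,
Question 1.4 (is `𝔐₀ = Σ₂(S⁴, ρ¹P(−2,3,7))` diffeomorphic to `S⁴`?), their eq. (3) and the
"Rokhlin" remark on p. 9–10; soloist notes `work/s51/cp2-sphere-correction.md` §4 (Lemma P, claim C625).

## The topological inputs (prose hypotheses; NOT formalised here)

Let `𝕋 ⊂ S⁴` be the unknotted torus, `P = S⁴ ∖ ν𝕋`, and use the basis `(C₁, C₂, μ)` of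
`H₁(∂P) = ℤ³`: `C₁, C₂` are the `0`-push-offs of a symplectic basis of `H₁(𝕋)` (each bounds a framed
disc in `P`), `μ` is the meridian.  The Rokhlin quadratic form on `K = ⟨C₁, C₂⟩` is
`q(a C₁ + b C₂) = a b (mod 2)` (`q(C₁) = q(C₂) = 0`, `q(C₁ + C₂) = 1`).

* (P1) Every diffeomorphism `F` of `P` preserves `K = ker (H₁ ∂P → H₁ P)`, so the images of `C₁, C₂`
  have no `μ`-component, and the induced `2 × 2` block preserves `q` (0-push-offs and framed
  surfaces are intrinsic to `(P, ∂P)`).  We call an integer `3 × 3` matrix satisfying these two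
  NECESSARY conditions `ANec` below (columns = images of `C₁, C₂, μ`).  [Lemma P (i),(ii).]
* (P2) With `Y = Σ₂(E(P(−2,3,7)))` (hyperbolic, one cusp, `H¹(Y;ℤ) = ℤ`) and the basis
  `(m, l, s) = (μ̃_J, λ̃, pt × S¹)` of `H₁(∂(Y × S¹))`, the image of `Diff(Y × S¹)` on `H₁(∂)` is the
  group `B = {m ↦ ε₁ m + k s, l ↦ ε₂ l, s ↦ ε₃ s}` (Mostow–Prasad for the `Isom(Y)`-part, the vertical
  shears `(y, θ) ↦ (y, θ + f_k(y))` for `H¹(Y;ℤ)`).  [Programme's Thm 9.5/9.5′; Lemma P, Corollary.]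
* (P3) HKM eq. (3): `X_m = P ∪_{g_m} (Y × S¹)` with `g : C₁ ↔ m`, `μ ↔ l`,
  `γ = j C₁ + C₂ + μ ↔ s` (`j = m/2`; `j = 9` for `X₁₈ = S⁴`), and `X_{m+2} = P ∪_{δ g_m} (Y × S¹)`
  with `δ : C₂ ↦ C₁ + C₂` (one Dehn twist of `𝕋̃` about `C̃₁`, HKM Claim 2.3); `𝔐₀ = X₂₀`, `S⁴ = X₁₈`.

A diffeomorphism `X₁₈ → X₂₀` mapping the splitting 3-torus `∂P` to itself exists iff
`δ ∈ A · B^g` (sides are forced, `P ≇ Y × S¹`), i.e. iff `δ ∘ b ∈ A` for some `b ∈ B^g`.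

## What is proved here (pure integer-matrix arithmetic, kernel-checked)

Coordinates: index `0 = C₁`, `1 = C₂`, `2 = μ`; matrices act on column vectors, so COLUMN `i` is the
image of basis vector `i` and ROW `2` lists the `μ`-components of the images.

* `gMat j`, `gInv j`: the change of basis `(C₁,C₂,μ) ↔ (m,l,s)` of (P3) and its inverse;
* `bMLS k ε₁ ε₂ ε₃`: the family `B` of (P2) in `(m,l,s)`-coordinates; `bFam j … := gInv j * bMLS … * gMat j`
  is `B^g` in `(C₁,C₂,μ)`-coordinates, with the closed form `bFam_explicit`
  (its `μ`-row is `(k, ε₃ - j k - ε₂, ε₂)`);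
* `delta n`: `C₂ ↦ n C₁ + C₂` (`n = 1` is HKM's `δ`, `n = 2` is Claim 2.2's double twist);
* `splitting_nogo`: for `n, ε₁, ε₃` odd and ALL `j, k, ε₂`, neither `delta n * bFam …` nor
  `bFam … * delta n` satisfies `ANec` — the `μ`-row forces `k = 0` and `ε₃ = ε₂`, and then the torus
  block is `≡ [[1, 1], [0, 1]] (mod 2)`, which breaks `q`;
* `delta_even_mem`: for `n` even, `delta n` itself satisfies the full membership predicate `AMem`
  (consistent with `X_m ≅ X_{m+4}`);
* `shear_mem`: the meridian shears `μ ↦ μ + v₁ C₁ + v₂ C₂` of Lemma P (iv) lie in `AMem`;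
* `stabQ_mod_two`: over `ZMod 2` the invertible `2 × 2` matrices preserving `q` are exactly `1` and
  the coordinate swap (`decide`).

Consequently (given (P1)–(P3)): no diffeomorphism `S⁴ = X₁₈ → X₂₀ = 𝔐₀` preserves HKM's 3-torus;
any proof of Q1.4 must move that 3-torus (as HKM's Claim 2.3 does inside `CP̄²`) or use a different
splitting.  This file contains no topology; it certifies only the arithmetic of the double-coset
statement `δ ∉ A · B^g`.
-/

namespace Summit.SmoothPoincare4.SmoothPoincare4.Theorems

open Matrix

/-- The torus block of `F` (images of `C₁, C₂` in `K`-coordinates) preserves the Rokhlin form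
`q(a, b) = a b (mod 2)`: `q` of the image of `C₁` is `0`, of `C₂` is `0`, of `C₁ + C₂` is `1`. -/
def PreservesQ (F : Matrix (Fin 3) (Fin 3) ℤ) : Prop :=
  Even (F 0 0 * F 1 0) ∧ Even (F 0 1 * F 1 1) ∧ Odd ((F 0 0 + F 0 1) * (F 1 0 + F 1 1))

/-- The images of `C₁, C₂` have no `μ`-component (`F` preserves `K = ⟨C₁, C₂⟩`). -/
def MuClean (F : Matrix (Fin 3) (Fin 3) ℤ) : Prop :=
  F 2 0 = 0 ∧ F 2 1 = 0

/-- The two NECESSARY conditions for membership in `A = image of π₀ Diff(P)` (Lemma P (i),(ii)). -/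
def ANec (F : Matrix (Fin 3) (Fin 3) ℤ) : Prop :=
  MuClean F ∧ PreservesQ F

/-- Full membership predicate for `A`: additionally `μ ↦ ±μ + (element of K)` and unimodularity. -/
def AMem (F : Matrix (Fin 3) (Fin 3) ℤ) : Prop :=
  ANec F ∧ (F 2 2 = 1 ∨ F 2 2 = -1) ∧ (F.det = 1 ∨ F.det = -1)

/-- `delta n : C₁ ↦ C₁, C₂ ↦ n C₁ + C₂, μ ↦ μ` (`n` Dehn twists of `𝕋̃` about `C̃₁`). -/
def delta (n : ℤ) : Matrix (Fin 3) (Fin 3) ℤ :=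
  !![1, n, 0; 0, 1, 0; 0, 0, 1]

/-- The meridian shear `μ ↦ μ + v₁ C₁ + v₂ C₂` of Lemma P (iv). -/
def shear (v₁ v₂ : ℤ) : Matrix (Fin 3) (Fin 3) ℤ :=
  !![1, 0, v₁; 0, 1, v₂; 0, 0, 1]

/-- Change of basis `(C₁, C₂, μ) → (m, l, s)`: `C₁ = m`, `C₂ = s - j m - l`, `μ = l`. -/
def gMat (j : ℤ) : Matrix (Fin 3) (Fin 3) ℤ :=
  !![1, -j, 0; 0, -1, 1; 0, 1, 0]

/-- Its inverse `(m, l, s) → (C₁, C₂, μ)`: `m = C₁`, `l = μ`, `s = j C₁ + C₂ + μ`. -/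
def gInv (j : ℤ) : Matrix (Fin 3) (Fin 3) ℤ :=
  !![1, 0, j; 0, 0, 1; 0, 1, 1]

/-- The family `B` of (P2) in `(m, l, s)`-coordinates: `m ↦ ε₁ m + k s`, `l ↦ ε₂ l`, `s ↦ ε₃ s`. -/
def bMLS (k ε₁ ε₂ ε₃ : ℤ) : Matrix (Fin 3) (Fin 3) ℤ :=
  !![ε₁, 0, 0; 0, ε₂, 0; k, 0, ε₃]

/-- `B^g`: the family `B` transported to `(C₁, C₂, μ)`-coordinates. -/
def bFam (j k ε₁ ε₂ ε₃ : ℤ) : Matrix (Fin 3) (Fin 3) ℤ :=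
  gInv j * bMLS k ε₁ ε₂ ε₃ * gMat j

/-- `gMat j` and `gInv j` are mutually inverse (first direction). -/
theorem gMat_mul_gInv (j : ℤ) : gMat j * gInv j = 1 := by
  ext i k
  fin_cases i <;> fin_cases k <;> simp [gMat, gInv, Matrix.mul_apply, Fin.sum_univ_three]

/-- `gMat j` and `gInv j` are mutually inverse (second direction). -/
theorem gInv_mul_gMat (j : ℤ) : gInv j * gMat j = 1 := by
  ext i k
  fin_cases i <;> fin_cases k <;> simp [gMat, gInv, Matrix.mul_apply, Fin.sum_univ_three]

/-- `B` is closed under composition (it is a group of matrices). -/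
theorem bMLS_mul (k ε₁ ε₂ ε₃ k' ε₁' ε₂' ε₃' : ℤ) :
    bMLS k ε₁ ε₂ ε₃ * bMLS k' ε₁' ε₂' ε₃' =
      bMLS (k * ε₁' + ε₃ * k') (ε₁ * ε₁') (ε₂ * ε₂') (ε₃ * ε₃') := by
  ext i k
  fin_cases i <;> fin_cases k <;>
    simp [bMLS, Matrix.mul_apply, Fin.sum_univ_three]

/-- Closed form of `B^g` in `(C₁, C₂, μ)`-coordinates; row `2` (the `μ`-components of the images of
`C₁, C₂, μ`) is `(k, ε₃ - j k - ε₂, ε₂)`. -/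
theorem bFam_explicit (j k ε₁ ε₂ ε₃ : ℤ) :
    bFam j k ε₁ ε₂ ε₃ =
      !![ε₁ + j * k, j * (ε₃ - j * k) - j * ε₁, 0;
         k, ε₃ - j * k, 0;
         k, ε₃ - j * k - ε₂, ε₂] := by
  ext i k
  fin_cases i <;> fin_cases k <;>
    simp [bFam, bMLS, gMat, gInv, Matrix.mul_apply, Fin.sum_univ_three] <;> ring

/-- `B^g` is closed under composition as well. -/
theorem bFam_mul (j k ε₁ ε₂ ε₃ k' ε₁' ε₂' ε₃' : ℤ) :
    bFam j k ε₁ ε₂ ε₃ * bFam j k' ε₁' ε₂' ε₃' =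
      bFam j (k * ε₁' + ε₃ * k') (ε₁ * ε₁') (ε₂ * ε₂') (ε₃ * ε₃') := by
  rw [bFam, bFam, bFam, ← bMLS_mul]
  simp only [Matrix.mul_assoc]
  rw [← Matrix.mul_assoc (gMat j) (gInv j), gMat_mul_gInv, Matrix.one_mul]

/-- HKM's `δ` composed on either side with any element of `B^g`: the `μ`-row. -/
theorem delta_mul_bFam_row (n j k ε₁ ε₂ ε₃ : ℤ) :
    (delta n * bFam j k ε₁ ε₂ ε₃) 2 0 = k ∧
    (delta n * bFam j k ε₁ ε₂ ε₃) 2 1 = ε₃ - j * k - ε₂ ∧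
    (delta n * bFam j k ε₁ ε₂ ε₃) 2 2 = ε₂ := by
  rw [bFam_explicit]
  refine ⟨?_, ?_, ?_⟩ <;> simp [delta, Matrix.mul_apply, Fin.sum_univ_three]

/-- Row `2` (the `μ`-components) of `B^g ∘ δⁿ`. -/
theorem bFam_mul_delta_row (n j k ε₁ ε₂ ε₃ : ℤ) :
    (bFam j k ε₁ ε₂ ε₃ * delta n) 2 0 = k ∧
    (bFam j k ε₁ ε₂ ε₃ * delta n) 2 1 = n * k + (ε₃ - j * k - ε₂) ∧
    (bFam j k ε₁ ε₂ ε₃ * delta n) 2 2 = ε₂ := by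
  rw [bFam_explicit]
  (refine ⟨?_, ?_, ?_⟩ <;> simp [delta, Matrix.mul_apply, Fin.sum_univ_three]); ring

/-- Parity lemma: for `n, ε₁, ε₃` odd and any `j`, the product
`(j (ε₃ - ε₁) + n ε₃) ε₃` is odd. -/
theorem odd_key (n j ε₁ ε₃ : ℤ) (hn : Odd n) (h₁ : Odd ε₁) (h₃ : Odd ε₃) :
    Odd ((j * (ε₃ - ε₁) + n * ε₃) * ε₃) := by
  have h31 : Even (ε₃ - ε₁) := Odd.sub_odd h₃ h₁
  have hj : Even (j * (ε₃ - ε₁)) := h31.mul_left j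
  have hn3 : Odd (n * ε₃) := hn.mul h₃
  exact (hj.add_odd hn3).mul h₃

/-- Variant used for the other order of composition. -/
theorem odd_key' (n j ε₁ ε₃ : ℤ) (hn : Odd n) (h₁ : Odd ε₁) (h₃ : Odd ε₃) :
    Odd ((n * ε₁ + (j * (ε₃ - ε₁))) * ε₃) := by
  have h31 : Even (ε₃ - ε₁) := Odd.sub_odd h₃ h₁
  have hj : Even (j * (ε₃ - ε₁)) := h31.mul_left j
  have hn1 : Odd (n * ε₁) := hn.mul h₁
  have : Odd (n * ε₁ + j * (ε₃ - ε₁)) := by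
    rw [add_comm]; exact hj.add_odd hn1
  exact this.mul h₃

/-- **Splitting no-go (arithmetic core of C625).**  For `n` odd (in particular HKM's `δ = delta 1`)
and `ε₁, ε₃` odd (in particular `± 1`), and for ALL `j, k, ε₂`: neither `δ ∘ b` nor `b ∘ δ`
(`b ∈ B^g`) satisfies the two necessary conditions for lying in the image of `π₀ Diff(S⁴ ∖ ν𝕋)`.
Hence `δ ∉ A · B^g` and `δ ∉ B^g · A`. -/
theorem splitting_nogo (n j k ε₁ ε₂ ε₃ : ℤ) (hn : Odd n) (h₁ : Odd ε₁) (h₃ : Odd ε₃) :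
    ¬ ANec (delta n * bFam j k ε₁ ε₂ ε₃) ∧ ¬ ANec (bFam j k ε₁ ε₂ ε₃ * delta n) := by
  obtain ⟨r0, r1, -⟩ := delta_mul_bFam_row n j k ε₁ ε₂ ε₃
  obtain ⟨s0, s1, -⟩ := bFam_mul_delta_row n j k ε₁ ε₂ ε₃
  constructor
  · rintro ⟨⟨hk, hε⟩, -, hq2, -⟩
    -- μ-row: k = 0 and ε₃ = ε₂
    rw [r0] at hk
    rw [r1] at hε
    subst hk
    -- the (0,1) and (1,1) entries of δ ∘ b
    have e01 : (delta n * bFam j 0 ε₁ ε₂ ε₃) 0 1 = j * ε₃ - j * ε₁ + n * ε₃ := by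
      rw [bFam_explicit]; simp [delta, Matrix.mul_apply, Fin.sum_univ_three]
    have e11 : (delta n * bFam j 0 ε₁ ε₂ ε₃) 1 1 = ε₃ := by
      rw [bFam_explicit]; simp [delta, Matrix.mul_apply, Fin.sum_univ_three]
    rw [e01, e11] at hq2
    have hodd := odd_key n j ε₁ ε₃ hn h₁ h₃
    have : (j * ε₃ - j * ε₁ + n * ε₃) * ε₃ = (j * (ε₃ - ε₁) + n * ε₃) * ε₃ := by ring
    rw [this] at hq2
    exact (Int.not_even_iff_odd.mpr hodd) hq2
  · rintro ⟨⟨hk, hε⟩, -, hq2, -⟩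
    rw [s0] at hk
    rw [s1] at hε
    subst hk
    have e01 : (bFam j 0 ε₁ ε₂ ε₃ * delta n) 0 1 = n * ε₁ + (j * ε₃ - j * ε₁) := by
      rw [bFam_explicit]; simp [delta, Matrix.mul_apply, Fin.sum_univ_three]; ring
    have e11 : (bFam j 0 ε₁ ε₂ ε₃ * delta n) 1 1 = ε₃ := by
      rw [bFam_explicit]; simp [delta, Matrix.mul_apply, Fin.sum_univ_three]
    rw [e01, e11] at hq2
    have hodd := odd_key' n j ε₁ ε₃ hn h₁ h₃
    have : (n * ε₁ + (j * ε₃ - j * ε₁)) * ε₃ = (n * ε₁ + j * (ε₃ - ε₁)) * ε₃ := by ring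
    rw [this] at hq2
    exact (Int.not_even_iff_odd.mpr hodd) hq2

/-- The HKM instance: `δ = delta 1`, `j = 9` (`X₁₈`), signs `± 1`. -/
theorem splitting_nogo_HKM (k ε₁ ε₂ ε₃ : ℤ)
    (h₁ : ε₁ = 1 ∨ ε₁ = -1) (h₃ : ε₃ = 1 ∨ ε₃ = -1) :
    ¬ ANec (delta 1 * bFam 9 k ε₁ ε₂ ε₃) ∧ ¬ ANec (bFam 9 k ε₁ ε₂ ε₃ * delta 1) := by
  apply splitting_nogo 1 9 k ε₁ ε₂ ε₃ odd_one
  · rcases h₁ with h | h <;> subst h <;> decide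
  · rcases h₃ with h | h <;> subst h <;> decide

/-- `δⁿ` is unimodular. -/
theorem delta_det (n : ℤ) : (delta n).det = 1 := by
  simp [delta, Matrix.det_fin_three]

/-- For `n` EVEN, `delta n` itself lies in `A` (full predicate): two Dehn twists about `C̃₁` are
realised (HKM Claim 2.2, `X_m ≅ X_{m+4}`). -/
theorem delta_even_mem (n : ℤ) (hn : Even n) : AMem (delta n) := by
  refine ⟨⟨⟨by simp [delta], by simp [delta]⟩, ?_, ?_, ?_⟩, Or.inl (by simp [delta]),
    Or.inl (delta_det n)⟩
  · simp [delta]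
  · simpa [delta] using hn
  · have h1n : Odd (1 + n) := odd_one.add_even hn
    simpa [delta] using h1n

/-- For `n` ODD, `delta n` alone already fails the necessary conditions (HKM's Rokhlin remark). -/
theorem delta_odd_not_mem (n : ℤ) (hn : Odd n) : ¬ ANec (delta n) := by
  rintro ⟨-, -, hq2, -⟩
  simp [delta] at hq2
  exact (Int.not_even_iff_odd.mpr hn) hq2

/-- `δ` generates a one-parameter group: `δᵃ δᵇ = δᵃ⁺ᵇ`. -/
theorem delta_mul_delta (a b : ℤ) : delta a * delta b = delta (a + b) := by
  ext i k
  (fin_cases i <;> fin_cases k <;> simp [delta, Matrix.mul_apply, Fin.sum_univ_three]); ring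

/-- Shears are unimodular. -/
theorem shear_det (v₁ v₂ : ℤ) : (shear v₁ v₂).det = 1 := by
  simp [shear, Matrix.det_fin_three]

/-- The meridian shears of Lemma P (iv) satisfy the full membership predicate. -/
theorem shear_mem (v₁ v₂ : ℤ) : AMem (shear v₁ v₂) := by
  refine ⟨⟨⟨by simp [shear], by simp [shear]⟩, ?_, ?_, ?_⟩, Or.inl (by simp [shear]),
    Or.inl (shear_det v₁ v₂)⟩
  · simp [shear]
  · simp [shear]
  · simp [shear]

/-- The shears form a copy of `ℤ²`. -/
theorem shear_mul (v₁ v₂ w₁ w₂ : ℤ) : shear v₁ v₂ * shear w₁ w₂ = shear (v₁ + w₁) (v₂ + w₂) := by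
  ext i k
  fin_cases i <;> fin_cases k <;> simp [shear, Matrix.mul_apply, Fin.sum_univ_three] <;> ring

/-- The shear sends the meridian `μ = e₂` to `μ + v₁ C₁ + v₂ C₂` and fixes `C₁, C₂`. -/
theorem shear_mulVec_mu (v₁ v₂ : ℤ) :
    (shear v₁ v₂).mulVec ![0, 0, 1] = ![v₁, v₂, 1] ∧
    (shear v₁ v₂).mulVec ![1, 0, 0] = ![1, 0, 0] ∧
    (shear v₁ v₂).mulVec ![0, 1, 0] = ![0, 1, 0] := by
  refine ⟨?_, ?_, ?_⟩ <;> ext i <;> fin_cases i <;>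
    simp [shear, Matrix.mulVec, dotProduct, Fin.sum_univ_three]

/-- The Rokhlin form `q(a, b) = a b` on `(ZMod 2)²` and the stabiliser statement:
an invertible `2 × 2` matrix over `ZMod 2` (columns = images of `e₁, e₂`) preserves `q` iff it is
the identity or the coordinate swap. -/
abbrev preservesQ₂ (M : Matrix (Fin 2) (Fin 2) (ZMod 2)) : Prop :=
  M 0 0 * M 1 0 = 0 ∧ M 0 1 * M 1 1 = 0 ∧ (M 0 0 + M 0 1) * (M 1 0 + M 1 1) = 1

/-- The coordinate swap. -/
def swap₂ : Matrix (Fin 2) (Fin 2) (ZMod 2) := !![0, 1; 1, 0]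

/-- Stabiliser of the Rokhlin form mod 2: an invertible matrix over `ZMod 2` preserves `q` iff it is
the identity or the coordinate swap (checked by `decide` over the 16 matrices). -/
theorem stabQ_mod_two :
    ∀ M : Matrix (Fin 2) (Fin 2) (ZMod 2), M.det ≠ 0 →
      (preservesQ₂ M ↔ (M = 1 ∨ M = swap₂)) := by
  decide

/-- In particular the block `[[1, 1], [0, 1]]` (one Dehn twist, reduced mod 2) does not preserve `q`,
while `1` and the swap do. -/
theorem dehn_block_breaks_q : ¬ preservesQ₂ !![1, 1; 0, 1] ∧ preservesQ₂ 1 ∧ preservesQ₂ swap₂ := by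
  decide

end Summit.SmoothPoincare4.SmoothPoincare4.Theorems
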